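import Summits.NavierStokesRegularity.NavierStokesRegularity.Theorems.ScenarioCensusRowF1ax
import Summits.NavierStokesRegularity.NavierStokesRegularity.Theorems.TypeICertificateLadderRungZero
import Literature.Analysis.FluidPDE.BarkerPrange2020VorticityAlignmentTypeIHolds
import Literature.Analysis.FluidPDE.TypeIAncientMildTimeAnalytic
import Literature.Analysis.FluidPDE.TypeIAncientMildRescale
import Summits.NavierStokesRegularity.NavierStokesRegularity.Theorems.LocalHelicityTubeDoorFrobeniusProfileRigidityHelicalSlice
import HarnessLib
import Summits.NavierStokesRegularity.NavierStokesRegularity.Theorems.ScenarioCensusRowF1EchoTopRows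

/-!
# Census row F1, the SCALING axis — self-maps of the top under the scaling group read at SNAPSHOTS (cells F1sps ≡ the line's `Row_F1ss` «similar pockets», F1ds, F1hs; floors SSF /
# DSF / HF) — LINE 40 «scaling-top» port, part 1/4: §1 objects (frame of LINES 34–39 BY NAME; `SimilarPocketAt`, `DssWindowAt`, `HomogeneousPocketAt`, the floors, the rows
# `Row_F1ss` / `Row_F1ds` / `Row_F1hs`); §2–§3 compactness, socket, Leray's every-time floor and the witness zoom package (LINES 37 / 39 BY NAME); §4a THE SCALING KILLS — continuation
# in the scale parameter (`rel_all_of_ball`, `similar_allScales`, `scaleInvariant_of_allScales`, KS `eq_zero_of_similar` via the tree's Tsai theorem, `dss_allTimes`)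

Re-homed for the scenario census (typer seat ns-census-typer-1 g10; the cells «similar-pocket snapshots» / F1ds / F1hs and the floors SSF / DSF / HF are MEMBERS OF RECORD «DECIDED IN
KERNEL IN FILES» of row F1 (item 85: critic idea-crit-3 g10 PASS no price tier B 12:32:22Z; ref PRE-CHECK ✓ §19.17; lead label); this port makes them TREE-decided): VERBATIM PORT of
ns-idea-3 LINE 40 «scaling-top», `pub/ideators/ns-idea-3/lines/scaling-top/line-scaling-top.lean` sha16 3435a148b4d1d87d (1360 l., lean check rc 0, 0 sorry), split for the 400-line
rule into `ScenarioCensusRowF1ScalingTop` (§1–§4a) → `…ScalingTopKill` (§4b) → `…ScalingTopFloors` (§5) → `…ScalingTopRows` (§6–§7 + census KEYS).  Lean text VERBATIM in namespace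
`…Theorems.ScenarioCensus.ScalingTop` (the line's `…Cruxes.ScenarioCensusRowF1.ScalingTopLine` re-homed); port edits: the frame restated VERBATIM by the line from LINES 34–39 (`topSet`,
`HasTypeIConstant`, `snapLevel`, `exists_fast_at`, `sqrt_mul_sq_mul`, `limitClass_compact`, `exists_level_of_limitKill`, `exists_witnessZoom_package`, `zoom_units`,
`eventually_forall_not_of_not_frequently`) is taken BY NAME from the landed two-time-top / one-level-top / snapshot-top / needle-top / echo-top ports, and the alias `centre_mem` is the tree's `IsTypeIAncientMild.comp_add_right` (Literature, BY NAME); the bookkeeping lemma `tendstoLocallyUniformly_comp_of_tendsto` (a twin of a landed lemma in a route-cone module) is not re-declared, its 3-line proof is inlined in `tendsto_eval`; `rowF1ss_holds` is spelled `: ScalingTop.Row_F1ss` (same statement; the unqualified text coincides with «stretched-top»'s `rowF1ss_holds`); `@[conjecture]` on the residual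
`SimilarCollapse` (≡ `ScenarioCensus.Row_F1`, OPEN); one-line docstrings added where missing (gate lint).  Statements untouched; the line's row keeps its name `ScalingTop.Row_F1ss`,
only its census KEY is spelled `Row_F1sps` because `ScenarioCensus.Row_F1ss` is «stretched-top»'s cell F1ss (slot 9, `ScenarioCensusRowF1StretchedTop.lean` :231).

No census VALUE is moved here (row F1 stays OPEN-WITH-LINE; the members become TREE-decided by name); NS regularity is NOT proved; `Row_F1` is untouched (zero
movement, `similarCollapse_iff_rowF1`); no summit statement is proved by this file. Lemmas that restate already-landed tree declarations are taken BY NAME (gate lint `dedup.landed`): `topSet` = `TwoTimeTop.topSet`, `HasTypeIConstant` = `OneLevelTop.HasTypeIConstant`, `snapLevel` = `SnapshotTop.snapLevel`, `exists_fast_at` = `SnapshotTop.exists_fast_at`, `sqrt_mul_sq_mul` = `SnapshotTop.sqrt_mul_sq_mul`, `limitClass_compact` = `NeedleTop.limitClass_compact`, `exists_level_of_limitKill` = `NeedleTop.exists_level_of_limitKill`, `zoom_units` = `NeedleTop.zoom_units`, `exists_witnessZoom_package` = `EchoTop.exists_witnessZoom_package`, `eventually_forall_not_of_not_frequently` = `EchoTop.eventually_forall_not_of_not_frequently`,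 `centre_mem` = `IsTypeIAncientMild.comp_add_right`.
-/

-- the summit and its single problem share the name `NavierStokesRegularity` (D-0017 nested layout)
set_option linter.dupNamespace false

noncomputable section

open MeasureTheory Set Function Filter TopologicalSpace Metric
open scoped Topology NNReal ENNReal InnerProductSpace

namespace Summit.NavierStokesRegularity.NavierStokesRegularity.Theorems.ScenarioCensus.ScalingTop

open Literature.Analysis Literature.Analysis.FluidPDE
open Summit.NavierStokesRegularity.NavierStokesRegularity.Theorems
open Summit.NavierStokesRegularity.NavierStokesRegularity.Theses
open Summit.NavierStokesRegularity.NavierStokesRegularity.Theorems.LocalHelicityTubeDoorFrobeniusProfileRigidityHelicalSlice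

/-- `ℝ³`. -/
abbrev E3 := EuclideanSpace ℝ (Fin 3)

/-! ## §1 Objects: top, dimensionless Type-I constant, Leray's level `c_S` (frame, verbatim); the SCALING read-outs (a SIMILAR pocket
over a range of factors, a DSS window for a pair of factors, a HOMOGENEOUS pocket over a range of dilations); floors, rows -/

-- `topSet`: the line restates the tree's `TwoTimeTop.topSet`; taken BY NAME (gate lint dedup.landed).

-- `HasTypeIConstant`: the line restates the tree's `OneLevelTop.HasTypeIConstant`; taken BY NAME (gate lint dedup.landed).

-- `snapLevel`: the line restates the tree's `SnapshotTop.snapLevel`; taken BY NAME (gate lint dedup.landed).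

/-- **A SIMILAR POCKET at the instant `t` about the point `x`** (factor range `[l₁, l₂] ⊂ (0, ∞)`, apex reach `A`, radius `a`,
threshold `ε`; parabolic unit `ℓ = √(ν(T − t))`, speed unit `√ν/√(T − t)`): there is an APEX `x_* = x + ℓ b`, `‖b‖ ≤ A`, such that on
the pocket of radius `a ℓ` about `x_*` the snapshot at the instant `t` IS — to dimensionless accuracy `ε` — the LERAY RESCALING, about the
space–time apex `(T, x_*)` and by EVERY factor `λ ∈ [l₁, l₂]`, of the snapshot at the instant `T − λ²(T − t)`:
`√(T − t) ‖u(t, x_* + ℓw) − λ • u(T − λ²(T − t), x_* + λℓw)‖ ≤ ε √ν` for `‖w‖ ≤ a`.  NOTHING is asked to be small or slow — an exactly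
backward self-similar profile `u(t, x_* + z) = (T − t)^{−1/2} U(z/√(T − t))` satisfies it with `ε = 0` for every factor, at full speed
(`similarPocketAt_of_selfSimilar`); `λ > 1` compares with EARLIER instants, `λ < 1` with LATER ones (all before `T`).  ONE factor
(`l₁ = l₂`) would be a DISCRETELY self-similar read-out: deliberately NOT a cell of this line (the open backward-DSS scenario). -/
def SimilarPocketAt (ν T : ℝ) (u : ℝ → E3 → E3) (l₁ l₂ A a ε t : ℝ) (x : E3) : Prop :=
  ∃ b : E3, ‖b‖ ≤ A ∧ ∀ lam ∈ Icc l₁ l₂, ∀ w : E3, ‖w‖ ≤ a →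
    Real.sqrt (T - t) * ‖u t (x + (Real.sqrt (ν * (T - t))) • (b + w))
      - lam • u (T - lam ^ 2 * (T - t)) (x + (Real.sqrt (ν * (T - t))) • (b + lam • w))‖ ≤ ε * Real.sqrt ν

/-- **A DSS WINDOW for the factor PAIR `(λ, λ')` at `x`** (window depth `K`, apex reach `A`, radius `a`, threshold `ε`): there is an apex
`x_* = x + ℓ b`, `‖b‖ ≤ A`, such that THROUGHOUT the window of instants `τ ∈ [T − K(T − t), t]` and on the pocket of radius `aℓ` about
`x_*` the flow repeats — to accuracy `ε`, in the units of the instant `t` — its own Leray rescaling about `(T, x_*)` by the factor `λ` AND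
by the factor `λ'`:  `√(T − t) ‖u(τ, x_* + ℓw) − λ • u(T − λ²(T − τ), x_* + λℓw)‖ ≤ ε √ν`, and the same with `λ'`.  With `log λ / log λ'`
IRRATIONAL (incommensurable factors, e.g. `(2, 3)`) this is a cell of the line; ONE factor, or a commensurable pair (`(2, 4)`), is the
open backward-DSS scenario and is NOT claimed. -/
def DssWindowAt (ν T : ℝ) (u : ℝ → E3 → E3) (lam lam' K A a ε t : ℝ) (x : E3) : Prop :=
  ∃ b : E3, ‖b‖ ≤ A ∧ ∀ τ ∈ Icc (T - K * (T - t)) t, ∀ w : E3, ‖w‖ ≤ a →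
    Real.sqrt (T - t) * ‖u τ (x + (Real.sqrt (ν * (T - t))) • (b + w))
      - lam • u (T - lam ^ 2 * (T - τ)) (x + (Real.sqrt (ν * (T - t))) • (b + lam • w))‖ ≤ ε * Real.sqrt ν ∧
    Real.sqrt (T - t) * ‖u τ (x + (Real.sqrt (ν * (T - t))) • (b + w))
      - lam' • u (T - lam' ^ 2 * (T - τ)) (x + (Real.sqrt (ν * (T - t))) • (b + lam' • w))‖ ≤ ε * Real.sqrt ν

/-- **A HOMOGENEOUS POCKET at the instant `t` about `x`** (dilation range `[μ₁, μ₂]`, apex reach `A`, radius `a`, threshold `ε`): there is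
an apex `x_* = x + ℓ b`, `‖b‖ ≤ A`, about which the SNAPSHOT at the instant `t` is, to accuracy `ε`, HOMOGENEOUS OF DEGREE `−1` — the
Navier–Stokes weight — over the whole range of dilations:  `√(T − t) ‖μ • u(t, x_* + μℓw) − u(t, x_* + ℓw)‖ ≤ ε √ν` for `‖w‖ ≤ a`,
`μ ∈ [μ₁, μ₂]`.  (The snapshots of Landau's `(−1)`-homogeneous solutions about their singular point satisfy it exactly; no smallness is
asked; for a dilation range reaching down to `μ = 0` the read-out degenerates into LINE 36's calm pocket, which is why the interesting
range is `μ₁ > 0` — the theorems below need no sign condition at all.) -/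
def HomogeneousPocketAt (ν T : ℝ) (u : ℝ → E3 → E3) (μ₁ μ₂ A a ε t : ℝ) (x : E3) : Prop :=
  ∃ b : E3, ‖b‖ ≤ A ∧ ∀ μ ∈ Icc μ₁ μ₂, ∀ w : E3, ‖w‖ ≤ a →
    Real.sqrt (T - t) * ‖μ • u t (x + (Real.sqrt (ν * (T - t))) • (b + μ • w))
      - u t (x + (Real.sqrt (ν * (T - t))) • (b + w))‖ ≤ ε * Real.sqrt ν

/-- **THE SIMILAR FLOOR** (structural theorem for EVERY Clay solution with a dimensionless Type-I constant `M`; PROVED,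
`similarFloor_holds`): for every level `Λ > 0`, factor range `0 < l₁ < l₂`, reach `A` and radius `a > 0` there is
`ε = ε(M, Λ, l₁, l₂, A, a) > 0` such that, for all instants `t < T` close enough to `T`, NO `Λ`-fast point has an `ε`-similar pocket with
these parameters.  (No maximality / blow-up hypothesis; the quantifier over fast points is UNIVERSAL.) -/
def SimilarFloor : Prop :=
  ∀ (M Λ l₁ l₂ A a : ℝ), 0 < Λ → 0 < l₁ → l₁ < l₂ → 0 < a → ∃ ε : ℝ, 0 < ε ∧
    ∀ (ν T : ℝ), 0 < ν → 0 < T → ∀ (u : ℝ → E3 → E3) (p : ℝ → E3 → ℝ),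
    IsClassicalNSSolutionOn (Ico 0 T) ν 0 u p → IsLerayHopfOn T ν 0 (u 0) u →
    HasRapidSpatialDecay (u 0) → OneLevelTop.HasTypeIConstant ν T M u →
    ∀ᶠ t in 𝓝[<] T, ∀ x ∈ TwoTimeTop.topSet ν T u Λ t, ¬ SimilarPocketAt ν T u l₁ l₂ A a ε t x

/-- **THE DSS-PAIR FLOOR** (PROVED, `dssFloor_holds`): for every level `Λ > 0`, factors `λ, λ' > 0` with `log λ / log λ'` IRRATIONAL,
depth `K > 1`, reach `A`, radius `a > 0` there is `ε > 0` such that eventually NO `Λ`-fast point has an `ε`-DSS window for the pair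
`(λ, λ')`. -/
def DssFloor : Prop :=
  ∀ (M Λ lam lam' K A a : ℝ), 0 < Λ → 0 < lam → 0 < lam' → Irrational (Real.log lam / Real.log lam') → 1 < K → 0 < a →
    ∃ ε : ℝ, 0 < ε ∧
    ∀ (ν T : ℝ), 0 < ν → 0 < T → ∀ (u : ℝ → E3 → E3) (p : ℝ → E3 → ℝ),
    IsClassicalNSSolutionOn (Ico 0 T) ν 0 u p → IsLerayHopfOn T ν 0 (u 0) u →
    HasRapidSpatialDecay (u 0) → OneLevelTop.HasTypeIConstant ν T M u →
    ∀ᶠ t in 𝓝[<] T, ∀ x ∈ TwoTimeTop.topSet ν T u Λ t, ¬ DssWindowAt ν T u lam lam' K A a ε t x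

/-- **THE HOMOGENEOUS FLOOR** (PROVED, `homogeneousFloor_holds`): for every level `Λ > 0`, dilation range `μ₁ < μ₂`, reach `A`, radius
`a > 0` there is `ε > 0` such that eventually NO `Λ`-fast point has an `ε`-homogeneous pocket. -/
def HomogeneousFloor : Prop :=
  ∀ (M Λ μ₁ μ₂ A a : ℝ), 0 < Λ → μ₁ < μ₂ → 0 < a → ∃ ε : ℝ, 0 < ε ∧
    ∀ (ν T : ℝ), 0 < ν → 0 < T → ∀ (u : ℝ → E3 → E3) (p : ℝ → E3 → ℝ),
    IsClassicalNSSolutionOn (Ico 0 T) ν 0 u p → IsLerayHopfOn T ν 0 (u 0) u →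
    HasRapidSpatialDecay (u 0) → OneLevelTop.HasTypeIConstant ν T M u →
    ∀ᶠ t in 𝓝[<] T, ∀ x ∈ TwoTimeTop.topSet ν T u Λ t, ¬ HomogeneousPocketAt ν T u μ₁ μ₂ A a ε t x

/-- **ROW F1ss «SIMILAR POCKETS»** (Type I · no symmetry · Clay class; census shape; PROVED, `rowF1ss_holds`, a corollary of the floor
at Leray's level `c_S`): for every `M`, factor range `0 < l₁ < l₂`, reach `A`, radius `a > 0` there is `ε > 0` such that: if along SOME
sequence of instants `t_k ↑ T` every `c_S`-fast point has an `ε`-similar pocket, the solution extends smoothly past `T`. -/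
def Row_F1ss : Prop :=
  ∀ (M l₁ l₂ A a : ℝ), 0 < l₁ → l₁ < l₂ → 0 < a → ∃ ε : ℝ, 0 < ε ∧
    ∀ (ν T : ℝ), 0 < ν → 0 < T → ∀ (u : ℝ → E3 → E3) (p : ℝ → E3 → ℝ),
    IsClassicalNSSolutionOn (Ico 0 T) ν 0 u p → IsLerayHopfOn T ν 0 (u 0) u →
    HasRapidSpatialDecay (u 0) → OneLevelTop.HasTypeIConstant ν T M u →
    (∃ᶠ t in 𝓝[<] T, ∀ x ∈ TwoTimeTop.topSet ν T u SnapshotTop.snapLevel t, SimilarPocketAt ν T u l₁ l₂ A a ε t x) →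
    HasSmoothExtensionPast ν 0 u T

/-- **ROW F1ds «INCOMMENSURABLE DSS WINDOWS»** (Type I · no symmetry · Clay class; PROVED, `rowF1ds_holds`): for every `M`, factors
`λ, λ' > 0` with `log λ / log λ'` irrational, depth `K > 1`, reach `A`, radius `a > 0` there is `ε > 0` such that: if along some `t_k ↑ T`
every `c_S`-fast point has an `ε`-DSS window for the pair `(λ, λ')`, the solution extends smoothly past `T`. -/
def Row_F1ds : Prop :=
  ∀ (M lam lam' K A a : ℝ), 0 < lam → 0 < lam' → Irrational (Real.log lam / Real.log lam') → 1 < K → 0 < a →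
    ∃ ε : ℝ, 0 < ε ∧
    ∀ (ν T : ℝ), 0 < ν → 0 < T → ∀ (u : ℝ → E3 → E3) (p : ℝ → E3 → ℝ),
    IsClassicalNSSolutionOn (Ico 0 T) ν 0 u p → IsLerayHopfOn T ν 0 (u 0) u →
    HasRapidSpatialDecay (u 0) → OneLevelTop.HasTypeIConstant ν T M u →
    (∃ᶠ t in 𝓝[<] T, ∀ x ∈ TwoTimeTop.topSet ν T u SnapshotTop.snapLevel t, DssWindowAt ν T u lam lam' K A a ε t x) →
    HasSmoothExtensionPast ν 0 u T

/-- **ROW F1hs «HOMOGENEOUS SNAPSHOTS»** (Type I · no symmetry · Clay class; PROVED, `rowF1hs_holds`): for every `M`, dilation range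
`μ₁ < μ₂`, reach `A`, radius `a > 0` there is `ε > 0` such that: if along some `t_k ↑ T` every `c_S`-fast point has an `ε`-homogeneous
pocket, the solution extends smoothly past `T`. -/
def Row_F1hs : Prop :=
  ∀ (M μ₁ μ₂ A a : ℝ), μ₁ < μ₂ → 0 < a → ∃ ε : ℝ, 0 < ε ∧
    ∀ (ν T : ℝ), 0 < ν → 0 < T → ∀ (u : ℝ → E3 → E3) (p : ℝ → E3 → ℝ),
    IsClassicalNSSolutionOn (Ico 0 T) ν 0 u p → IsLerayHopfOn T ν 0 (u 0) u →
    HasRapidSpatialDecay (u 0) → OneLevelTop.HasTypeIConstant ν T M u →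
    (∃ᶠ t in 𝓝[<] T, ∀ x ∈ TwoTimeTop.topSet ν T u SnapshotTop.snapLevel t, HomogeneousPocketAt ν T u μ₁ μ₂ A a ε t x) →
    HasSmoothExtensionPast ν 0 u T

/-! ## §2 COMPACTNESS of `𝒦_M` (values pointwise AND locally uniformly on slices, gradients pointwise) and the SOCKET LEMMA

`𝒦_M` = `IsTypeIAncientMild M`.  The tree's extraction theorem `exists_tendsto_of_typeI_seq_Ioo` (KNSS 2009, Lemma 6.1) fed with
MEMBERS of `𝒦_M` is the sequential compactness of `𝒦_M` (values pointwise and locally uniformly on slices, gradients pointwise;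
LINES 36–39 VERBATIM).  A SCALING read-out is evaluated at points `b_j + λ•w` that MOVE with the apex `b_j` of the zoom, so this line
uses the LOCALLY UNIFORM clause (as LINE 38 did for its moving stars): after a further compactness step on the apex, a locally uniformly
convergent sequence of slices is evaluated along convergent sequences of points (`TendstoLocallyUniformly.tendsto_comp`). -/

-- `limitClass_compact`: the line restates the tree's `NeedleTop.limitClass_compact`; taken BY NAME (gate lint dedup.landed).

-- `tendstoLocallyUniformly_comp_of_tendsto`: a statement-twin of the landed `AdaptedFrequencyTangentFlowTransfer.tendstoLocallyUniformly_comp_of_tendsto` (whose module imports a route file and is therefore NOT imported here; gate lint dedup.landed); not re-declared — its 3-line folklore proof (subsequences of locally uniformly convergent sequences) is inlined in `tendsto_eval`.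

-- `exists_level_of_limitKill`: the line restates the tree's `NeedleTop.exists_level_of_limitKill`; taken BY NAME (gate lint dedup.landed).

/-! ## §3 Leray's EVERY-TIME floor (for the census rows) and the WITNESS ZOOM PACKAGE (LINE 39 VERBATIM: zooms centred at GIVEN fast points)

LINES 36–38 centred their zooms at `c_S`-fast points supplied by Leray's every-time lower rate under NON-extension (`SnapshotTop.exists_fast_at`,
kept here for the census-shaped rows).  THE WITNESS PACKAGE below instead takes the centres FROM THE HYPOTHESIS: if frequently as
`t ↑ T` there is a `Λ`-fast point `x` with a property `Q t x`, the zooms centred at such `(t_j, x_j)` converge in `𝒦_M` (SAME `M`) to a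
limit with `‖W(−1, 0)‖ ≥ Λ` — for ANY level `Λ`, with NO maximality hypothesis (the Type-I window alone runs the tree's zoom lemmas
`zoom_continuousOn` / `zoom_isWeaklyDivFree` / `zoom_oseen` / `zoom_norm_le` and the extraction `exists_tendsto_of_typeI_seq_Ioo`).
This is what makes the floors UNIVERSAL over fast points (every `Λ`-fast point fails the scaling read-out), where LINES 36–38 could
only say that SOME `c_S`-fast point fails to be calm. -/

-- `exists_fast_at`: the line restates the tree's `SnapshotTop.exists_fast_at`; taken BY NAME (gate lint dedup.landed).

-- `sqrt_mul_sq_mul`: the line restates the tree's `SnapshotTop.sqrt_mul_sq_mul`; taken BY NAME (gate lint dedup.landed).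

-- `exists_witnessZoom_package`: the line restates the tree's `EchoTop.exists_witnessZoom_package`; taken BY NAME (gate lint dedup.landed).

/-! ## §4 THE SCALING KILLS (new) — analytic continuation in the SCALE / TIME parameter, a closed-subgroup dichotomy, and the tree's
Liouville theorems for the scaling group BY NAME

All three kills run on `𝒦_M` and end in a tree theorem quoted BY NAME:
* (KS) SIMILAR pocket over a RANGE of factors `λ ∈ [l₁, l₂]` ⇒ `W ≡ 0`: extend the relation in the point (analytic slices) and in the
  FACTOR (joint analyticity `IsTypeIAncientMild.analyticAt_uncurry` along the analytic curve `λ ↦ (−λ², λ•w)`, identity theorem on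
  `(0, ∞)`), convert «all factors at the slice −1» into full backward self-similarity `λ•W(λ²s, λ•y) = W(s, y)` and quote Tsai's theorem
  `PoloidalWindowDoorPoloidalWindowRigidityStrata.eq_zero_of_scaleInvariant` (Tsai 1998, `q = ∞`, in tree).
* (KD) DSS window for TWO factors `λ, λ'` with `log λ / log λ'` IRRATIONAL ⇒ `W ≡ 0`: extend in the point and in TIME (`analyticAt_time`,
  identity theorem on `(−∞, 0)`); the set of `a : ℝ` for which `W` is `eᵃ`-DSS is a CLOSED ADDITIVE SUBGROUP containing `log λ, log λ'`,
  hence all of `ℝ` (`AddSubgroup.dense_or_cyclic`) — `W` is self-similar — Tsai again.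
* (KH) HOMOGENEOUS snapshot over a RANGE of dilations `μ ∈ [μ₁, μ₂]` ⇒ `W ≡ 0`: extend in the point and in `μ` (slice analyticity along
  `μ ↦ μ•w`), then quote `LocalHelicityTubeDoorFrobeniusProfileRigidityHelicalSlice.eq_zero_of_homogeneous_slice` (a `(−1)`-homogeneous
  slice is singular at its centre unless zero). -/

-- `centre_mem`: the line restates the tree's `IsTypeIAncientMild.comp_add_right`; taken BY NAME (gate lint dedup.landed).

/-- Slices of a member of `𝒦_M` are continuous (they are real-analytic, tree `analyticOnNhd_slice_univ`). -/
theorem continuous_slice' {M : ℝ} {W : ℝ → E3 → E3} (hW : IsTypeIAncientMild M W) {s : ℝ} (hs : s < 0) :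
    Continuous (W s) :=
  continuousOn_univ.1 (hW.analyticOnNhd_slice_univ hs).continuousOn

/-- **Point continuation.** A two-slice relation `W σ₁ w = c • W σ₂ (lam • w)` on a ball about `0` holds everywhere (analytic slices,
identity theorem on `E3`). -/
theorem rel_all_of_ball {M : ℝ} {W : ℝ → E3 → E3} (hW : IsTypeIAncientMild M W) {σ₁ σ₂ a : ℝ} (hσ₁ : σ₁ < 0) (hσ₂ : σ₂ < 0)
    (ha : 0 < a) (c lam : ℝ) (h : ∀ w ∈ ball (0 : E3) a, W σ₁ w = c • W σ₂ (lam • w)) :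
    ∀ w : E3, W σ₁ w = c • W σ₂ (lam • w) := by
  have h1 : AnalyticOnNhd ℝ (W σ₁) univ := hW.analyticOnNhd_slice_univ hσ₁
  have h2 : AnalyticOnNhd ℝ (fun w : E3 => c • W σ₂ (lam • w)) univ := by
    intro w _
    have hlin : AnalyticAt ℝ (fun w : E3 => lam • w) w := analyticAt_id.fun_const_smul (c := lam)
    have hc : AnalyticAt ℝ (W σ₂) (lam • w) := hW.analyticOnNhd_slice_univ hσ₂ _ (mem_univ _)
    have hcomp : AnalyticAt ℝ (fun w : E3 => W σ₂ (lam • w)) w :=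
      AnalyticAt.comp (g := W σ₂) (f := fun w : E3 => lam • w) (x := w) hc hlin
    exact hcomp.fun_const_smul (c := c)
  have hev : W σ₁ =ᶠ[𝓝 (0 : E3)] fun w : E3 => c • W σ₂ (lam • w) := by
    filter_upwards [isOpen_ball.mem_nhds (mem_ball_self ha)] with w hw
    exact h w hw
  have heq := h1.eqOn_of_preconnected_of_eventuallyEq h2 isPreconnected_univ (mem_univ 0) hev
  exact fun w => heq (mem_univ w)

/-- **Factor continuation (the new move).** If `W(−1, w) = λ • W(−λ², λ•w)` for all `w` and all `λ` in a non-degenerate interval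
`[l₁, l₂] ⊂ (0, ∞)`, then it holds for EVERY `λ > 0`: `λ ↦ λ • W(−λ², λ•w)` is real-analytic on `(0, ∞)` by the JOINT space–time
analyticity of `W` (tree `IsTypeIAncientMild.analyticAt_uncurry`) along the analytic curve `λ ↦ (−λ², λ•w)`. -/
theorem similar_allScales {M : ℝ} {W : ℝ → E3 → E3} (hW : IsTypeIAncientMild M W) {l₁ l₂ : ℝ} (h1 : 0 < l₁) (h12 : l₁ < l₂)
    (h : ∀ lam ∈ Icc l₁ l₂, ∀ w : E3, W (-1) w = lam • W (-lam ^ 2) (lam • w)) :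
    ∀ lam : ℝ, 0 < lam → ∀ w : E3, W (-1) w = lam • W (-lam ^ 2) (lam • w) := by
  intro lam hlam w
  have hφ : AnalyticOnNhd ℝ (fun μ : ℝ => μ • W (-μ ^ 2) (μ • w)) (Ioi 0) := by
    intro μ hμ
    have hμ2 : -μ ^ 2 < (0 : ℝ) := by have := pow_pos (show (0 : ℝ) < μ from hμ) 2; linarith
    have hU : AnalyticAt ℝ (uncurry W) (-μ ^ 2, μ • w) := hW.analyticAt_uncurry hμ2 _
    have hc1 : AnalyticAt ℝ (fun μ : ℝ => -μ ^ 2) μ := (analyticAt_id.fun_pow 2).fun_neg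
    have hc2 : AnalyticAt ℝ (fun μ : ℝ => μ • w) μ := analyticAt_id.fun_smul analyticAt_const
    have hcomp : AnalyticAt ℝ (fun μ : ℝ => W (-μ ^ 2) (μ • w)) μ := hU.comp₂ hc1 hc2
    exact analyticAt_id.fun_smul hcomp
  have hψ : AnalyticOnNhd ℝ (fun μ : ℝ => μ • W (-μ ^ 2) (μ • w) - W (-1) w) (Ioi 0) := fun μ hμ =>
    (hφ μ hμ).fun_sub analyticAt_const
  have hm : (l₁ + l₂) / 2 ∈ Ioi (0 : ℝ) := by simp only [mem_Ioi]; linarith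
  have hev : (fun μ : ℝ => μ • W (-μ ^ 2) (μ • w) - W (-1) w) =ᶠ[𝓝 ((l₁ + l₂) / 2)] 0 := by
    filter_upwards [Ioo_mem_nhds (show l₁ < (l₁ + l₂) / 2 by linarith) (show (l₁ + l₂) / 2 < l₂ by linarith)] with μ hμ
    simp only [Pi.zero_apply]
    rw [← h μ ⟨hμ.1.le, hμ.2.le⟩ w]
    exact sub_self _
  have hzero := hψ.eqOn_zero_of_preconnected_of_eventuallyEq_zero isPreconnected_Ioi hm hev
  have h0 : lam • W (-lam ^ 2) (lam • w) - W (-1) w = 0 := hzero hlam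
  exact (sub_eq_zero.1 h0).symm

/-- **Algebra.** «all factors at the slice `−1`» is full backward self-similarity `λ • W(λ² s, λ•y) = W(s, y)` (`λ > 0`, `s < 0`). -/
theorem scaleInvariant_of_allScales {W : ℝ → E3 → E3}
    (h : ∀ lam : ℝ, 0 < lam → ∀ w : E3, W (-1) w = lam • W (-lam ^ 2) (lam • w)) :
    ∀ lam : ℝ, 0 < lam → ∀ s < 0, ∀ y : E3, lam • W (lam ^ 2 * s) (lam • y) = W s y := by
  intro lam hlam s hs y
  set m := Real.sqrt (-s) with hm
  have hm0 : 0 < m := Real.sqrt_pos.2 (neg_pos.2 hs)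
  have hm2 : m ^ 2 = -s := Real.sq_sqrt (neg_pos.2 hs).le
  have hA := h m hm0 (m⁻¹ • y)
  have hB := h (lam * m) (mul_pos hlam hm0) (m⁻¹ • y)
  have e1 : m • m⁻¹ • y = y := by rw [smul_smul, mul_inv_cancel₀ hm0.ne', one_smul]
  have e2 : (lam * m) • m⁻¹ • y = lam • y := by rw [smul_smul, mul_assoc, mul_inv_cancel₀ hm0.ne', mul_one]
  have e3 : -m ^ 2 = s := by rw [hm2, neg_neg]
  have e4 : -(lam * m) ^ 2 = lam ^ 2 * s := by rw [mul_pow, hm2]; ring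
  rw [e1, e3] at hA
  rw [e2, e4] at hB
  have hAB : m • W s y = (m * lam) • W (lam ^ 2 * s) (lam • y) := by rw [mul_comm m lam]; exact hA.symm.trans hB
  rw [mul_smul] at hAB
  exact (smul_right_injective E3 hm0.ne' hAB).symm

/-- **(KS) A SIMILAR POCKET OVER A RANGE OF FACTORS KILLS.**  `W ∈ 𝒦_M`, an apex `b`, a radius `a > 0`, factors `0 < l₁ < l₂`, and
`W(−1, b + w) = λ • W(−λ², b + λ•w)` for `λ ∈ [l₁, l₂]`, `‖w‖ < a`.  Then `W ≡ 0` on the open past (point continuation, factor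
continuation, algebra, Tsai's theorem `eq_zero_of_scaleInvariant` BY NAME). -/
theorem eq_zero_of_similar {M : ℝ} {W : ℝ → E3 → E3} (hW : IsTypeIAncientMild M W) (b : E3) {a l₁ l₂ : ℝ} (ha : 0 < a)
    (h1 : 0 < l₁) (h12 : l₁ < l₂)
    (hsim : ∀ lam ∈ Icc l₁ l₂, ∀ w ∈ ball (0 : E3) a, W (-1) (b + w) = lam • W (-lam ^ 2) (b + lam • w)) :
    ∀ s < 0, ∀ y : E3, W s y = 0 := by
  have hV : IsTypeIAncientMild M (fun s y => W s (y + b)) := IsTypeIAncientMild.comp_add_right hW b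
  have hall : ∀ lam ∈ Icc l₁ l₂, ∀ w : E3,
      (fun s y => W s (y + b)) (-1) w = lam • (fun s y => W s (y + b)) (-lam ^ 2) (lam • w) := by
    intro lam hlam
    have hl : 0 < lam := h1.trans_le hlam.1
    have hσ : -lam ^ 2 < (0 : ℝ) := by have := pow_pos hl 2; linarith
    refine rel_all_of_ball hV (by norm_num) hσ ha lam lam fun w hw => ?_
    show W (-1) (w + b) = lam • W (-lam ^ 2) (lam • w + b)
    rw [add_comm w b, add_comm (lam • w) b]
    exact hsim lam hlam w hw
  have hsc := scaleInvariant_of_allScales (similar_allScales hV h1 h12 hall)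
  have hz := PoloidalWindowDoorPoloidalWindowRigidityStrata.eq_zero_of_scaleInvariant hV.hasTypeITimeDecay
    hV.continuousOn_uncurry (fun s t hst ht x => hV.mild_eq_heatExtension hst ht x) (fun t ht => hV.isDivFree ht) hsc
  intro s hs y
  have := hz s hs (y - b)
  simpa using this

/-- **Time continuation.** A DSS relation `W(s, w) = λ • W(λ² s, λ•w)` holding for all `w` and for `s` in `[−K, −1]` with `K > 1`
holds for every `s < 0` (tree `IsTypeIAncientMild.analyticAt_time`, identity theorem on `(−∞, 0)`). -/
theorem dss_allTimes {M : ℝ} {W : ℝ → E3 → E3} (hW : IsTypeIAncientMild M W) {K lam : ℝ} (hK : 1 < K) (hlam : 0 < lam)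
    (h : ∀ s ∈ Icc (-K) (-1), ∀ w : E3, W s w = lam • W (lam ^ 2 * s) (lam • w)) :
    ∀ s < 0, ∀ w : E3, W s w = lam • W (lam ^ 2 * s) (lam • w) := by
  intro s hs w
  have hφ : AnalyticOnNhd ℝ (fun σ : ℝ => W σ w - lam • W (lam ^ 2 * σ) (lam • w)) (Iio 0) := by
    intro σ hσ
    have hσ0 : σ < 0 := hσ
    have h1 : AnalyticAt ℝ (fun σ : ℝ => W σ w) σ := hW.analyticAt_time hσ0 w
    have hσ' : lam ^ 2 * σ < 0 := mul_neg_of_pos_of_neg (pow_pos hlam 2) hσ0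
    have h2 : AnalyticAt ℝ (fun σ' : ℝ => W σ' (lam • w)) (lam ^ 2 * σ) := hW.analyticAt_time hσ' (lam • w)
    have h3 : AnalyticAt ℝ (fun σ : ℝ => lam ^ 2 * σ) σ := analyticAt_const.fun_mul analyticAt_id
    have h4 : AnalyticAt ℝ (fun σ : ℝ => W (lam ^ 2 * σ) (lam • w)) σ :=
      AnalyticAt.comp (g := fun σ' : ℝ => W σ' (lam • w)) (f := fun σ : ℝ => lam ^ 2 * σ) (x := σ) h2 h3
    exact h1.fun_sub (h4.fun_const_smul (c := lam))
  have hm : -(K + 1) / 2 ∈ Iio (0 : ℝ) := by simp only [mem_Iio]; linarith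
  have hev : (fun σ : ℝ => W σ w - lam • W (lam ^ 2 * σ) (lam • w)) =ᶠ[𝓝 (-(K + 1) / 2)] 0 := by
    filter_upwards [Ioo_mem_nhds (show -K < -(K + 1) / 2 by linarith) (show -(K + 1) / 2 < -1 by linarith)] with σ hσ
    simp only [Pi.zero_apply]
    rw [h σ ⟨hσ.1.le, hσ.2.le⟩ w]
    exact sub_self _
  have hzero := hφ.eqOn_zero_of_preconnected_of_eventuallyEq_zero isPreconnected_Iio hm hev
  exact sub_eq_zero.1 (hzero hs)

end Summit.NavierStokesRegularity.NavierStokesRegularity.Theorems.ScenarioCensus.ScalingTop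

end
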